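import Summits.KontsevichZagierPeriods.KontsevichZagierPeriods.Theses.IsogenyCertificates
import Mathlib.Analysis.Polynomial.Basic

/-!
# `AlgebraicModuliRealPeriodCell` (stmt-KontsevichZagierPeriods-18265, route IsogenyCertificates) —
line `Sketch`, stub T (`stub_algXMapTransfer`), phase 1a (iii): end limits of the x-map (E2)

Port of the `ℚ`-line's stub file `IsogenyCertificatesXMapPeriodTransferStubCellEnds.lean` (crux
`XMapPeriodTransfer`, line `saturated-sign-cells`) to REAL data: end limits of the real x-map
`R = f/g` of a COPRIME real datum `(f, g, c)` (`f g : ℝ[X]`, `c : ℝ`) between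
`y² = P(x) = x³ + αx + β` and `y² = P'(x) = x³ + α'x + β'` (`α β α' β' : ℝ`), i.e.
`W = f'g − fg' ≠ 0` in `ℝ[X]` and `c²·g·(f³ + α'fg² + β'g³) = P·W²`:

* at every real `p` with `P(p)·W(p) = 0`: if `g(p) ≠ 0` then `R` is continuous at `p` and `R(p)` is
  a root of `P'` (evaluate the identity at `p`, `c ≠ 0`); if `g(p) = 0` then `f(p) ≠ 0` by
  coprimality, `g ≠ 0` on a punctured neighbourhood of `p`, and `|R| = |f|/|g| → ∞` there;
* at `+∞`: if `deg f > deg g` then `|R| → ∞`; if `deg f ≤ deg g = n` (`n ≥ 1` since `W ≠ 0`) then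
  `R → ℓ = f_n / g_n` and `ℓ` is a root of `P'` (the `X^{4n}`-coefficient of the identity reads
  `c²·g_n·(f_n³ + α' f_n g_n² + β' g_n³) = 0`, because `deg W ≤ 2n − 2`).

No algebraicity is needed (pure real analysis over Mathlib: `Polynomial.div_tendsto_atTop_*`,
`Polynomial.abs_div_tendsto_atTop_atTop_of_degree_gt`, `nhdsNE_le_cofinite`,
`Filter.Tendsto.inv_tendsto_nhdsGT_zero`). Statements are the `ℚ` ones with `(A : ℝ) ↦ α`,
`aeval y f ↦ f.eval y`, hypothesis order unchanged; no definitions are introduced.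

References: M. Kontsevich, D. Zagier, *Periods* (2001), §1.2; the statements here are elementary
real analysis of rational functions (folklore).
-/

noncomputable section

open Set Filter MeasureTheory Polynomial Topology

namespace Summit.KontsevichZagierPeriods.IsogenyCertificates.AlgRealPeriodCell.TransferCellEnds

/-! ### Algebra: degree of the Wronskian and the top coefficient of the identity -/

/-- A real datum has `c ≠ 0` and `g ≠ 0` (`g = 0` kills `W`; `c = 0` gives `P·W² = 0` in the
domain `ℝ[X]`, `P` monic). [folklore] -/
private theorem c_ne_zero_and_g_ne_zero {α β α' β' : ℝ} {f g : ℝ[X]} {c : ℝ}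
    (hW : derivative f * g - f * derivative g ≠ 0)
    (hI : C (c ^ 2) * g * (f ^ 3 + C α' * f * g ^ 2 + C β' * g ^ 3) =
        (X ^ 3 + C α * X + C β) * (derivative f * g - f * derivative g) ^ 2) : c ≠ 0 ∧ g ≠ 0 := by
  refine ⟨?_, ?_⟩
  · rintro rfl
    have hm : (X ^ 3 + (C α * X + C β) : ℝ[X]).Monic :=
      monic_X_pow_add (degree_linear_le.trans_lt (by norm_num))
    rw [← add_assoc] at hm
    simp only [ne_eq, OfNat.ofNat_ne_zero, not_false_eq_true, zero_pow, map_zero, zero_mul] at hI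
    exact (mul_ne_zero hm.ne_zero (pow_ne_zero 2 hW)) hI.symm
  · rintro rfl; exact hW (by simp)

/-- If `deg f ≤ deg g` and the Wronskian `f'g − fg'` is nonzero, then `deg g ≠ 0` (two constants
have zero Wronskian). [folklore] -/
theorem cellEnds_natDegree_ne_zero {f g : ℝ[X]} (hW : derivative f * g - f * derivative g ≠ 0)
    (hfg : f.natDegree ≤ g.natDegree) : g.natDegree ≠ 0 := by
  intro hg
  have hf : f.natDegree = 0 := Nat.le_zero.mp (hg ▸ hfg)
  exact hW (by rw [derivative_of_natDegree_zero hf, derivative_of_natDegree_zero hg, zero_mul,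
    mul_zero, sub_zero])

/-- For `deg f, deg g ≤ m + 1` the Wronskian `f'g − fg'` has degree `≤ 2m`: its
`X^{2m+1}`-coefficient is `(m+1) f_{m+1} g_{m+1} − f_{m+1} (m+1) g_{m+1} = 0`. [folklore] -/
theorem cellEnds_natDegree_wronskian_le {f g : ℝ[X]} {m : ℕ} (hf : f.natDegree ≤ m + 1)
    (hg : g.natDegree ≤ m + 1) :
    (derivative f * g - f * derivative g).natDegree ≤ 2 * m := by
  have hf' : (derivative f).natDegree ≤ m := (natDegree_derivative_le f).trans (by omega)
  have hg' : (derivative g).natDegree ≤ m := (natDegree_derivative_le g).trans (by omega)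
  have h1 : (derivative f * g).natDegree ≤ 2 * m + 1 :=
    natDegree_mul_le.trans ((add_le_add hf' hg).trans (by omega))
  have h2 : (f * derivative g).natDegree ≤ 2 * m + 1 :=
    natDegree_mul_le.trans ((add_le_add hf hg').trans (by omega))
  have h3 : (derivative f * g - f * derivative g).natDegree ≤ 2 * m + 1 :=
    (natDegree_sub_le _ _).trans (max_le h1 h2)
  have h4 : (derivative f * g - f * derivative g).coeff (2 * m + 1) = 0 := by
    have e1 : (derivative f * g).coeff (2 * m + 1) = (derivative f).coeff m * g.coeff (m + 1) := by
      rw [show 2 * m + 1 = m + (m + 1) by ring]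
      exact coeff_mul_add_eq_of_natDegree_le hf' hg
    have e2 : (f * derivative g).coeff (2 * m + 1) = f.coeff (m + 1) * (derivative g).coeff m := by
      rw [show 2 * m + 1 = (m + 1) + m by ring]
      exact coeff_mul_add_eq_of_natDegree_le hf hg'
    rw [coeff_sub, e1, e2, coeff_derivative, coeff_derivative]
    ring
  have h5 := natDegree_le_pred h3 h4
  omega

/-- **Top coefficient of the certificate identity.** If `deg f, deg g ≤ m + 1` then
`deg (P·W²) ≤ 4m + 3`, so comparing `X^{4m+4}`-coefficients in
`c²·g·(f³ + α'fg² + β'g³) = P·W²` gives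
`c²·g_{m+1}·(f_{m+1}³ + α' f_{m+1} g_{m+1}² + β' g_{m+1}³) = 0`. [folklore] -/
theorem cellEnds_coeff_top {α β α' β' : ℝ} {f g : ℝ[X]} {c : ℝ} {m : ℕ}
    (hI : C (c ^ 2) * g * (f ^ 3 + C α' * f * g ^ 2 + C β' * g ^ 3) =
        (X ^ 3 + C α * X + C β) * (derivative f * g - f * derivative g) ^ 2)
    (hf : f.natDegree ≤ m + 1) (hg : g.natDegree ≤ m + 1) :
    c ^ 2 * g.coeff (m + 1) * (f.coeff (m + 1) ^ 3 +
      α' * f.coeff (m + 1) * g.coeff (m + 1) ^ 2 + β' * g.coeff (m + 1) ^ 3) = 0 := by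
  have hW := cellEnds_natDegree_wronskian_le hf hg
  have hP : (X ^ 3 + C α * X + C β : ℝ[X]).natDegree ≤ 3 := by compute_degree
  have hR : ((X ^ 3 + C α * X + C β) *
      (derivative f * g - f * derivative g) ^ 2).natDegree < (m + 1) + 3 * (m + 1) := by
    refine (natDegree_mul_le.trans (add_le_add hP (natDegree_pow_le_of_le 2 hW))).trans_lt ?_
    omega
  have h0 := coeff_eq_zero_of_natDegree_lt hR
  rw [← hI] at h0
  have h1 : (C (c ^ 2) * g).natDegree ≤ m + 1 := (natDegree_C_mul_le _ _).trans hg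
  have hQ : (f ^ 3 + C α' * f * g ^ 2 + C β' * g ^ 3).natDegree ≤ 3 * (m + 1) := by
    refine natDegree_add_le_of_degree_le (natDegree_add_le_of_degree_le
      (natDegree_pow_le_of_le 3 hf) (natDegree_mul_le.trans ?_))
      ((natDegree_C_mul_le _ _).trans (natDegree_pow_le_of_le 3 hg))
    have := add_le_add ((natDegree_C_mul_le α' f).trans hf) (natDegree_pow_le_of_le 2 hg)
    omega
  have e1 : (f ^ 3).coeff (3 * (m + 1)) = f.coeff (m + 1) ^ 3 := coeff_pow_of_natDegree_le hf
  have e2 : (C α' * f * g ^ 2).coeff (3 * (m + 1)) =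
      α' * f.coeff (m + 1) * g.coeff (m + 1) ^ 2 := by
    rw [show 3 * (m + 1) = (m + 1) + 2 * (m + 1) by ring, coeff_mul_add_eq_of_natDegree_le
      ((natDegree_C_mul_le _ _).trans hf) (natDegree_pow_le_of_le 2 hg), coeff_C_mul,
      coeff_pow_of_natDegree_le hg]
  have e3 : (C β' * g ^ 3).coeff (3 * (m + 1)) = β' * g.coeff (m + 1) ^ 3 := by
    rw [coeff_C_mul, coeff_pow_of_natDegree_le hg]
  rw [coeff_mul_add_eq_of_natDegree_le h1 hQ, coeff_C_mul, coeff_add, coeff_add, e1, e2, e3] at h0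
  exact h0

/-! ### Analysis at a finite point -/

/-- A nonzero real polynomial is nonzero on a punctured neighbourhood of every real point (it has
finitely many real roots and `𝓝[≠] p ≤ cofinite`). [folklore] -/
theorem cellEnds_eventually_ne_zero {g : ℝ[X]} (hg : g ≠ 0) (p : ℝ) :
    ∀ᶠ x in 𝓝[≠] p, g.eval x ≠ 0 := by
  filter_upwards [nhdsNE_le_cofinite p (finite_setOf_isRoot hg).compl_mem_cofinite] with x hx
  simpa [IsRoot] using hx

/-- **Pole.** If `g(p) = 0 ≠ f(p)` (and `g ≠ 0`) then `|f/g| → ∞` on the punctured neighbourhood of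
`p`: the numerator tends to `|f(p)| > 0`, the denominator to `0` through positive values. [folklore] -/
theorem cellEnds_tendsto_abs_div_atTop {f g : ℝ[X]} (hg : g ≠ 0) {p : ℝ} (hF : f.eval p ≠ 0)
    (hG : g.eval p = 0) :
    Tendsto (fun x : ℝ => |f.eval x / g.eval x|) (𝓝[≠] p) atTop := by
  have h1 : Tendsto (fun x : ℝ => |g.eval x|) (𝓝[≠] p) (𝓝[>] 0) := by
    refine tendsto_nhdsWithin_iff.mpr ⟨?_, ?_⟩
    · have h : Tendsto (fun x : ℝ => |g.eval x|) (𝓝 p) (𝓝 |g.eval p|) :=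
        (g.continuous.tendsto p).abs
      rw [hG, abs_zero] at h
      exact h.mono_left nhdsWithin_le_nhds
    · filter_upwards [cellEnds_eventually_ne_zero hg p] with x hx using abs_pos.mpr hx
  have h2 : Tendsto (fun x : ℝ => |f.eval x|) (𝓝[≠] p) (𝓝 |f.eval p|) :=
    ((f.continuous.tendsto p).abs).mono_left nhdsWithin_le_nhds
  have h3 := h2.pos_mul_atTop (abs_pos.mpr hF) h1.inv_tendsto_nhdsGT_zero
  refine h3.congr fun x => ?_
  simp [div_eq_mul_inv]

/-- **Regular end point.** If `P(p)·W(p) = 0` and `g(p) ≠ 0` then `R(p) = f(p)/g(p)` is a root of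
`P'`: evaluating the identity at `p` gives `c²·g(p)·(f³ + α'fg² + β'g³)(p) = P(p)·W(p)² = 0` with
`c ≠ 0`, `g(p) ≠ 0`; divide by `g(p)³`. [folklore] -/
theorem cellEnds_root_of_regular {α β α' β' : ℝ} {f g : ℝ[X]} {c : ℝ} (hc : c ≠ 0)
    (hI : C (c ^ 2) * g * (f ^ 3 + C α' * f * g ^ 2 + C β' * g ^ 3) =
        (X ^ 3 + C α * X + C β) * (derivative f * g - f * derivative g) ^ 2)
    {p : ℝ} (hp : (p ^ 3 + α * p + β) * (derivative f * g - f * derivative g).eval p = 0)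
    (hG : g.eval p ≠ 0) :
    (f.eval p / g.eval p) ^ 3 + α' * (f.eval p / g.eval p) + β' = 0 := by
  have hev := congrArg (eval p) hI
  simp only [eval_mul, eval_pow, eval_add, eval_C, eval_X] at hev
  have hzero : c ^ 2 * g.eval p *
      (f.eval p ^ 3 + α' * f.eval p * g.eval p ^ 2 + β' * g.eval p ^ 3) = 0 := by
    linear_combination hev + (derivative f * g - f * derivative g).eval p * hp
  have hc' : c ^ 2 ≠ 0 := pow_ne_zero _ hc
  have hQ : f.eval p ^ 3 + α' * f.eval p * g.eval p ^ 2 + β' * g.eval p ^ 3 = 0 :=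
    (mul_eq_zero.mp hzero).resolve_left (mul_ne_zero hc' hG)
  field_simp
  linear_combination hQ

/-! ### The registered sub-stub -/

/-- **Port of the registered stub `stub_cellEnds`** (E2, end limits) to real data. For a COPRIME
real datum: at every real `p` with `P(p)·W(p) = 0` the x-map `R = f/g` has a punctured limit which
is a root of `P'`, or `|R| → ∞`; and at `+∞` the same alternative holds (limit `f_n/g_n` when
`deg f ≤ deg g = n`, by the top-coefficient identity `cellEnds_coeff_top`). (`𝓝[≠] p` is written
`nhdsWithin p {p}ᶜ`.) [folklore] -/
theorem stub_cellEnds : ∀ (α β α' β' : ℝ) (f g : Polynomial ℝ) (c : ℝ), Polynomial.derivative f * g - f * Polynomial.derivative g ≠ 0 → Polynomial.C (c ^ 2) * g * (f ^ 3 + Polynomial.C α' * f * g ^ 2 + Polynomial.C β' * g ^ 3) = (Polynomial.X ^ 3 + Polynomial.C α * Polynomial.X + Polynomial.C β) * (Polynomial.derivative f * g - f * Polynomial.derivative g) ^ 2 → IsCoprime f g → ∀ (R W : ℝ → ℝ), R = (fun y => f.eval y / g.eval y) → W = (fun y => (Polynomial.derivative f * g - f * Polynomial.derivative g).eval y) →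 (∀ p : ℝ, (p ^ 3 + α * p + β) * W p = 0 → (∃ ℓ : ℝ, ℓ ^ 3 + α' * ℓ + β' = 0 ∧ Filter.Tendsto R (nhdsWithin p {p}ᶜ) (nhds ℓ)) ∨ Filter.Tendsto (fun x => |R x|) (nhdsWithin p {p}ᶜ) Filter.atTop) ∧ ((∃ ℓ : ℝ, ℓ ^ 3 + α' * ℓ + β' = 0 ∧ Filter.Tendsto R Filter.atTop (nhds ℓ)) ∨ Filter.Tendsto (fun x => |R x|) Filter.atTop Filter.atTop) := by
  intro α β α' β' f g c hW hI hcop R W hR hWd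
  obtain ⟨hc0, hg0⟩ := c_ne_zero_and_g_ne_zero hW hI
  subst hR hWd
  refine ⟨fun p hp => ?_, ?_⟩
  · by_cases hG : g.eval p = 0
    · right
      have hF : f.eval p ≠ 0 := by
        obtain ⟨u, v, huv⟩ := hcop
        have h := congrArg (eval p) huv
        simp only [eval_add, eval_mul, eval_one, hG, mul_zero, add_zero] at h
        intro hF
        rw [hF, mul_zero] at h
        exact zero_ne_one h
      exact cellEnds_tendsto_abs_div_atTop hg0 hF hG
    · left
      exact ⟨f.eval p / g.eval p, cellEnds_root_of_regular hc0 hI hp hG,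
        ((f.continuous.continuousAt.div₀ g.continuous.continuousAt hG).tendsto).mono_left
          nhdsWithin_le_nhds⟩
  · rcases lt_or_ge g.degree f.degree with hlt | hle
    · right
      exact f.abs_div_tendsto_atTop_atTop_of_degree_gt g hlt hg0
    · left
      have hle : f.degree ≤ g.degree := hle
      have hfn : f.natDegree ≤ g.natDegree := natDegree_le_natDegree hle
      obtain ⟨m, hm⟩ : ∃ m, g.natDegree = m + 1 :=
        Nat.exists_eq_succ_of_ne_zero (cellEnds_natDegree_ne_zero hW hfn)
      have hb : g.coeff (m + 1) ≠ 0 := by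
        rw [← hm, coeff_natDegree]; exact leadingCoeff_ne_zero.mpr hg0
      have key : f.coeff (m + 1) ^ 3 + α' * f.coeff (m + 1) * g.coeff (m + 1) ^ 2 +
          β' * g.coeff (m + 1) ^ 3 = 0 :=
        (mul_eq_zero.mp (cellEnds_coeff_top hI (hfn.trans hm.le) hm.le)).resolve_left
          (mul_ne_zero (pow_ne_zero _ hc0) hb)
      refine ⟨f.coeff (m + 1) / g.coeff (m + 1), ?_, ?_⟩
      · field_simp
        linear_combination key
      · rcases hle.lt_or_eq with hlt | heq
        · have hdeg : g.degree = ((m + 1 : ℕ) : WithBot ℕ) := by rw [degree_eq_natDegree hg0, hm]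
          have ha : f.coeff (m + 1) = 0 := coeff_eq_zero_of_degree_lt (hlt.trans_eq hdeg)
          rw [ha, zero_div]
          exact f.div_tendsto_atTop_zero_of_degree_lt g hlt
        · have h := f.div_tendsto_atTop_leadingCoeff_div_of_degree_eq g heq
          have hfn' : f.natDegree = m + 1 := (natDegree_eq_of_degree_eq heq).trans hm
          rw [← coeff_natDegree, ← coeff_natDegree, hfn', hm] at h
          exact h

end Summit.KontsevichZagierPeriods.IsogenyCertificates.AlgRealPeriodCell.TransferCellEnds

end
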